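import Summits.HodgeConjecture.HodgeConjecture.Theorems.DerivedTorelliFermatAssembly
import Summits.HodgeConjecture.HodgeConjecture.Theorems.DerivedTorelliFermatThirtyThreeGlue
import Summits.HodgeConjecture.HodgeConjecture.Theorems.DerivedTorelliFermatHodgeModels
import Literature.AlgebraicGeometry.HodgeTheory.HypersurfaceLefschetzUpper

/-!
# Equivalence audit q1 — `ResidualSectorComplement` (stmt-HodgeConjecture-13828)

Kernel-side companion of `EQUIVALENCE-AUDIT-q1.md` (strategist seat `cstrat-stmt-HodgeConjecture-13828-q1`,
mode SUSPECT EQUIVALENCE). Verdict: **equivalence-benign**.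

Imports: this file deliberately does NOT import
`Theorems.DerivedTorelliFermatResidualSectorComplement` / `…HypersurfaceLefschetz` (their closure
contains the unrelated route file `Theses.GaloisSieve`); the three folklore equivalences of strategist
r1 used below are re-derived inline (one line each, r1's names cited), and item 11281 is re-derived
from the Literature discharge exactly as its landed proof does.

What is certified here (no `sorry`, standard axioms only):

1. `audit_conjunct_split` — the flagged equivalence is the DESIGNED conjunct split of a declared
   sector route: `HC ↔ T ∧ C` with `T = FermatFourfoldsHCModResidual` (the route's target) and
   `C = ResidualSectorComplement = (T → HC)` (the declared, not-claimed frame).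
2. `audit_summitEquivalent_iff_target` — the flag is TIGHT: `(C ↔ HC) ↔ T`. The landed theorem
   `derivedTorelliFermat_residualSectorComplement_iff_hodgeConjecture : T → (C ↔ HC)` cannot be
   improved to an unconditional `C ↔ HC` without proving the route's open target `T`; so the
   `summit_equivalent` stamp on the item is exactly "conditional on stmt-HodgeConjecture-14576".
3. `audit_targetGlue` … `audit_thirtyThreeGlue` — the five PROVED siblings re-elaborated BY NAME at
   the route's decl types, with `#print axioms` (expected: `propext`, `Classical.choice`,
   `Quot.sound` only).
4. Non-vacuity witnesses: the target quantifies over an inhabited family in every degree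
   (`audit_target_domain_inhabited`), `HypersurfaceLefschetz` has inhabited antecedents
   (`audit_hypersurfaceLefschetz_antecedent_inhabited`, and a genuine consequence
   `audit_hypersurfaceLefschetz_consequence`), `HodgeModels` produces an actual Hodge model of the
   Fermat fourfold of degree 33 (`audit_hodgeModel_fermat33`), and the hypotheses of the open crux
   `Fermat33AccidentalClass` are inhabited by da Silva's character (`audit_fermat33_hypotheses_inhabited`).
-/

set_option linter.dupNamespace false

noncomputable section

namespace Summit.HodgeConjecture.HodgeConjecture.Cruxes.ResidualSectorComplement.EquivalenceAuditQ1

open Summit.HodgeConjecture.HodgeConjecture.Theses.DerivedTorelliFermat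
open Summit.HodgeConjecture.HodgeConjecture.Theorems
open Literature.AlgebraicGeometry.Motives Literature.AlgebraicGeometry.HodgeTheory

/-! ## 1. The flagged equivalence is the designed conjunct split -/

/-- `HC → T`: a smooth projective Fermat fourfold is a smooth projective fourfold (r1:
`derivedTorelliFermat_target_of_hodgeConjecture`). [folklore] -/
theorem audit_target_of_hodgeConjecture :
    _root_.HodgeConjecture → FermatFourfoldsHCModResidual :=
  fun hHC _m _ _hR _X _hF hX ↦ hHC hX

/-- `T → (C ↔ HC)` — the landed B↔S theorem under audit (r1:
`derivedTorelliFermat_residualSectorComplement_iff_hodgeConjecture`, re-derived). [folklore] -/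
theorem audit_flagged_equivalence (hT : FermatFourfoldsHCModResidual) :
    ResidualSectorComplement ↔ _root_.HodgeConjecture :=
  ⟨fun h ↦ h hT, fun hHC _ ↦ hHC⟩

/-- `HC ↔ T ∧ C` (r1: `derivedTorelliFermat_hodgeConjecture_iff_target_and_residualSectorComplement`,
re-derived). [folklore] -/
theorem audit_conjunct_split :
    _root_.HodgeConjecture ↔ FermatFourfoldsHCModResidual ∧ ResidualSectorComplement :=
  ⟨fun hHC ↦ ⟨audit_target_of_hodgeConjecture hHC, fun _ ↦ hHC⟩, fun h ↦ h.2 h.1⟩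

/-! ## 2. The flag is tight: `C` is summit-equivalent EXACTLY when the target holds -/

/-- `(C ↔ HC) ↔ T`: the B↔S equivalence recorded on the item holds iff the route's open target
holds; there is no unconditional equivalence to find or to fear. [folklore] -/
theorem audit_summitEquivalent_iff_target :
    (ResidualSectorComplement ↔ _root_.HodgeConjecture) ↔ FermatFourfoldsHCModResidual := by
  constructor
  · intro h
    by_contra hT
    have hC : ResidualSectorComplement := fun hT' ↦ absurd hT' hT
    exact hT (audit_target_of_hodgeConjecture (h.1 hC))
  · exact audit_flagged_equivalence

/-- Equivalently: `C` is unconditionally true iff `T → HC`, i.e. `C` carries no content beyond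
"the rest of the Hodge conjecture" — it is the declared residual, by `Iff.rfl`. [folklore] -/
theorem audit_frame_is_residual :
    ResidualSectorComplement ↔ (FermatFourfoldsHCModResidual → _root_.HodgeConjecture) :=
  Iff.rfl

/-! ## 3. The five proved siblings, by name, at the route's decl types -/

/-- stmt-HodgeConjecture-14582. -/
theorem audit_targetGlue : TargetGlue := derivedTorelliFermat_targetGlue_proof
/-- stmt-HodgeConjecture-11281 — the landed proof `derivedTorelliFermat_hypersurfaceLefschetz_proof`
is literally this term (the route decl is verbatim the body of the discharged named fact).
[cite: VoisinHodgeII2003, Thm. 1.23, Cor. 1.24 and Cor. 1.25] -/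
theorem audit_hypersurfaceLefschetz : HypersurfaceLefschetz :=
  Literature.AlgebraicGeometry.HodgeTheory.Voisin2003_smoothHypersurface_algebraicClasses_eq_top_holds
/-- stmt-HodgeConjecture-1943. -/
theorem audit_hodgeModels : HodgeModels := derivedTorelliFermat_hodgeModels_proof
/-- stmt-HodgeConjecture-14588. -/
theorem audit_assembly : Assembly := derivedTorelliFermat_assembly_proof
/-- stmt-HodgeConjecture-14298. -/
theorem audit_thirtyThreeGlue : ThirtyThreeGlue := derivedTorelliFermat_thirtyThreeGlue_proof

#print axioms Summit.HodgeConjecture.HodgeConjecture.Theorems.derivedTorelliFermat_targetGlue_proof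
#print axioms audit_hypersurfaceLefschetz
#print axioms Summit.HodgeConjecture.HodgeConjecture.Theorems.derivedTorelliFermat_hodgeModels_proof
#print axioms Summit.HodgeConjecture.HodgeConjecture.Theorems.derivedTorelliFermat_assembly_proof
#print axioms Summit.HodgeConjecture.HodgeConjecture.Theorems.derivedTorelliFermat_thirtyThreeGlue_proof
#print axioms audit_summitEquivalent_iff_target

/-! ## 4. Non-vacuity witnesses -/

/-- The target `T` quantifies over an INHABITED family in every degree `m ≥ 1`: the standard model
`V₊(Σ xᵢᵐ) ⊂ ℙ⁵` is a smooth projective Fermat fourfold of degree `m`.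
[cite: Hartshorne1977, I Ex. 5.5 and II Example 8.20.2] -/
theorem audit_target_domain_inhabited (m : ℕ) [NeZero m] :
    ∃ X : SchemeOver ℂ, IsFermatVariety 4 m X ∧ IsSmoothProjective 4 X :=
  ⟨fermatHypersurface 4 m, isFermatVariety_fermatHypersurface NeZero.one_le,
    isSmoothProjective_fermatHypersurface (by norm_num) NeZero.one_le⟩

/-- `HypersurfaceLefschetz` has inhabited antecedents (`n = 4`, `p = 1`: `0 < 1 < 4`, `2 ≠ 4`).
[cite: Hartshorne1977, I Ex. 5.5] -/
theorem audit_hypersurfaceLefschetz_antecedent_inhabited (m : ℕ) [NeZero m] :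
    ∃ Y : SchemeOver ℂ, IsSmoothHypersurface 4 m Y ∧ (0 < 1 ∧ 1 < 4 ∧ 2 * 1 ≠ 4) :=
  ⟨fermatHypersurface 4 m, isSmoothHypersurface_fermatHypersurface (by norm_num) NeZero.one_le,
    by omega⟩

/-- … and a genuine consequence: every codimension-1 class on a Fermat fourfold's standard model is
algebraic (Lefschetz `(1,1)` + hyperplane theorem), obtained by APPLYING the proved sibling.
[cite: VoisinHodgeII2003, Cor. 1.24–1.25] -/
theorem audit_hypersurfaceLefschetz_consequence (m : ℕ) [NeZero m] :
    algebraicClasses (fermatHypersurface 4 m) 1 = ⊤ :=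
  audit_hypersurfaceLefschetz (isSmoothHypersurface_fermatHypersurface (by norm_num) NeZero.one_le)
    1 one_pos (by norm_num) (by norm_num)

/-- `HodgeModels` is not junk-inhabited bookkeeping: applied to the Fermat fourfold of degree 33 it
PRODUCES a Hodge model (analytification + de Rham + Hodge decomposition data). [cite: SerreGAGA1956, §3] -/
theorem audit_hodgeModel_fermat33 : nonempty_hodgeModel 4 (fermatHypersurface 4 33) :=
  audit_hodgeModels 4 _

/-- The open crux `Fermat33AccidentalClass` has INHABITED hypotheses: da Silva's character
`(7,10,13,19,22,28)` of level `33` is a Hodge character and lies (with `t = 1`) in its own unit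
class — so the crux is not vacuously true. [cite: daSilva2021HodgeFermat, Prop. 3.6 (arXiv) = Prop. 3.4 (version of record)] -/
theorem audit_fermat33_hypotheses_inhabited :
    ∃ α : Fin (2 * 2 + 2) → ZMod 33, FermatCharacter.IsHodge α ∧
      ∃ t : (ZMod 33)ˣ, Finset.univ.val.map α =
        (({7, 10, 13, 19, 22, 28} : Multiset (ZMod 33)).map fun a => (t : ZMod 33) * a) := by
  refine ⟨![7, 10, 13, 19, 22, 28], ?_, 1, ?_⟩
  · rw [FermatCharacter.isHodge_iff_isHodgeMultiset]
    have h : Finset.univ.val.map (![7, 10, 13, 19, 22, 28] : Fin (2 * 2 + 2) → ZMod 33) =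
        ({7, 10, 13, 19, 22, 28} : Multiset (ZMod 33)) := by decide +kernel
    rw [h]
    unfold FermatCharacter.IsHodgeMultiset FermatCharacter.mNormSum
    decide +kernel
  · decide +kernel

end Summit.HodgeConjecture.HodgeConjecture.Cruxes.ResidualSectorComplement.EquivalenceAuditQ1

end
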